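import Mathlib
import Literature.NumberTheory.LFunctions.MoebiusHarmonicSumBound
import Literature.NumberTheory.LFunctions.MoebiusLogHarmonicSum
import Literature.NumberTheory.LFunctions.MoebiusSumClassicalBound
import Literature.NumberTheory.LFunctions.SiegelWalfiszMoebius
import Literature.NumberTheory.Sieve.CoprimeSquarefreeSums
import Summits.Parity.GeneralizedHardyLittlewood.Theses.LiouvilleShiftedTables

/-!
# `PairsFromMAvg`, part 1a: prime-number-theorem inputs for the truncated Möbius sums

Route `LiouvilleShiftedTables` (Parity / GeneralizedHardyLittlewood), support item stmt-Parity-14275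
(`Summit.Parity.GeneralizedHardyLittlewood.Theses.LiouvilleShiftedTables.PairsFromMAvg`,
Bombieri's asymptotic sieve at level 1 for `a_n = Λ(n + h)`: `EH → MAvg → PairsHL`).

Opening `Λ = μ ⋆ log` in `∑_{n ≤ N} Λ(n)Λ(n+h)` and truncating the Möbius variable produces the
three classical sums `∑_{d ≤ D, (d,h)=1} μ(d)/φ(d)`, `∑ μ(d) log d/φ(d)`, `∑ μ(d) d/φ(d)`, which are
evaluated (part 1b) through `m(y) = ∑_{e ≤ y} μ(e)/e`, `m₁(y) = ∑_{e ≤ y} μ(e) log e/e`,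
`M(y) = ∑_{e ≤ y} μ(e)`. This file collects:

* the three tree inputs (`Literature.NumberTheory.LFunctions.abs_sum_moebius_le_mul_exp_neg_sqrt_log`,
  `…abs_sum_moebius_div_le_exp_neg_sqrt_log`, `…abs_sum_moebius_mul_log_div_add_one_le`, all PROVED,
  de la Vallée-Poussin strength) converted to the `(log n)⁻²` currency at natural cutoffs, and the
  uniform bounds `|m| ≤ K`, `|m₁ + 1| ≤ K₁`, `|M(n)| ≤ n`;
* elementary inequalities for the splitting of `n ≤ D` at `n² ≤ D`;
* the hyperbola rearrangement `∑_{d ≤ D} (b ⋆ μ)(d) w(d) = ∑_{n ≤ D} b(n) ∑_{e ≤ D/n} μ(e) w(ne)`.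

[folklore; cite: MontgomeryVaughan2007, §8.1]
-/
noncomputable section

open Finset Real ArithmeticFunction Filter
open scoped ArithmeticFunction.Moebius ArithmeticFunction.zeta

namespace Summit.Parity.GeneralizedHardyLittlewood.Theorems.PairsFromMAvg

/-! ### PNT-strength Möbius inputs, in `(log x)⁻²` currency and at natural-number cutoffs -/

/-- `|M(n)| = |∑_{k ≤ n} μ(k)| ≤ C n/(log n)²` for `n ≥ 2` (de la Vallée-Poussin–Landau, from the tree's
`x exp(-c√log x)` bound). [folklore] -/
theorem exists_abs_sum_moebius_le_div_log_sq :
    ∃ C : ℝ, 0 ≤ C ∧ ∀ n : ℕ, 2 ≤ n → |∑ k ∈ Icc 1 n, (μ k : ℝ)| ≤ C * n / Real.log n ^ 2 := by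
  obtain ⟨c, hc, C, hM⟩ := Literature.NumberTheory.LFunctions.abs_sum_moebius_le_mul_exp_neg_sqrt_log
  obtain ⟨C', hC'0, hC'⟩ := Literature.NumberTheory.LFunctions.exists_mul_exp_neg_sqrt_log_le c hc 2
  refine ⟨max C 0 * C', by positivity, fun n hn => ?_⟩
  have hn' : (2 : ℝ) ≤ n := by exact_mod_cast hn
  have h1 := hM n hn'
  have hIoc : Ioc 0 n = Icc 1 n := by ext m; simp only [mem_Ioc, mem_Icc]; omega
  rw [Nat.floor_natCast, hIoc] at h1
  have h2 : (n : ℝ) * Real.exp (-c * Real.sqrt (Real.log n)) ≤ C' * n / Real.log n ^ 2 := by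
    have := hC' n hn'
    rwa [Real.rpow_two] at this
  have hE : 0 ≤ (n : ℝ) * Real.exp (-c * Real.sqrt (Real.log n)) := by positivity
  calc |∑ k ∈ Icc 1 n, (μ k : ℝ)| ≤ C * n * Real.exp (-c * Real.sqrt (Real.log n)) := h1
    _ ≤ max C 0 * (n * Real.exp (-c * Real.sqrt (Real.log n))) := by
        rw [mul_assoc]; exact mul_le_mul_of_nonneg_right (le_max_left _ _) hE
    _ ≤ max C 0 * (C' * n / Real.log n ^ 2) := mul_le_mul_of_nonneg_left h2 (le_max_right _ _)
    _ = max C 0 * C' * n / Real.log n ^ 2 := by ring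

/-- `|m(n)| = |∑_{k ≤ n} μ(k)/k| ≤ C/(log n)²` for `n ≥ 2`. [folklore] -/
theorem exists_abs_sum_moebius_div_le_div_log_sq :
    ∃ C : ℝ, 0 ≤ C ∧ ∀ n : ℕ, 2 ≤ n → |∑ k ∈ Icc 1 n, (μ k : ℝ) / k| ≤ C / Real.log n ^ 2 := by
  obtain ⟨c, hc, C, hm⟩ := Literature.NumberTheory.LFunctions.abs_sum_moebius_div_le_exp_neg_sqrt_log
  obtain ⟨C', hC'0, hC'⟩ := Literature.NumberTheory.LFunctions.exists_mul_exp_neg_sqrt_log_le c hc 2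
  refine ⟨max C 0 * C', by positivity, fun n hn => ?_⟩
  have hn' : (2 : ℝ) ≤ n := by exact_mod_cast hn
  have hn0 : (0 : ℝ) < n := by linarith
  have h1 := hm n hn'
  rw [Nat.floor_natCast] at h1
  have h2 : (n : ℝ) * Real.exp (-c * Real.sqrt (Real.log n)) ≤ C' * n / Real.log n ^ 2 := by
    have := hC' n hn'
    rwa [Real.rpow_two] at this
  have h3 : Real.exp (-c * Real.sqrt (Real.log n)) ≤ C' / Real.log n ^ 2 := by
    rw [show C' * n / Real.log n ^ 2 = n * (C' / Real.log n ^ 2) by ring] at h2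
    exact le_of_mul_le_mul_left h2 hn0
  calc |∑ k ∈ Icc 1 n, (μ k : ℝ) / k| ≤ C * Real.exp (-c * Real.sqrt (Real.log n)) := h1
    _ ≤ max C 0 * Real.exp (-c * Real.sqrt (Real.log n)) :=
        mul_le_mul_of_nonneg_right (le_max_left _ _) (Real.exp_pos _).le
    _ ≤ max C 0 * (C' / Real.log n ^ 2) := mul_le_mul_of_nonneg_left h3 (le_max_right _ _)
    _ = max C 0 * C' / Real.log n ^ 2 := by ring

/-- `|m₁(n) + 1| = |∑_{k ≤ n} μ(k) log k/k + 1| ≤ C/(log n)²` for `n ≥ 2` (Landau). [folklore] -/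
theorem exists_abs_sum_moebius_log_div_add_one_le_div_log_sq :
    ∃ C : ℝ, 0 ≤ C ∧ ∀ n : ℕ, 2 ≤ n →
      |∑ k ∈ Icc 1 n, (μ k : ℝ) * Real.log k / k + 1| ≤ C / Real.log n ^ 2 := by
  obtain ⟨c, hc, C, hm⟩ :=
    Literature.NumberTheory.LFunctions.abs_sum_moebius_mul_log_div_add_one_le
  obtain ⟨C', hC'0, hC'⟩ := Literature.NumberTheory.LFunctions.exists_mul_exp_neg_sqrt_log_le c hc 2
  refine ⟨max C 0 * C', by positivity, fun n hn => ?_⟩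
  have hn' : (2 : ℝ) ≤ n := by exact_mod_cast hn
  have hn0 : (0 : ℝ) < n := by linarith
  have h1 := hm n hn'
  rw [Nat.floor_natCast] at h1
  have h2 : (n : ℝ) * Real.exp (-c * Real.sqrt (Real.log n)) ≤ C' * n / Real.log n ^ 2 := by
    have := hC' n hn'
    rwa [Real.rpow_two] at this
  have h3 : Real.exp (-c * Real.sqrt (Real.log n)) ≤ C' / Real.log n ^ 2 := by
    rw [show C' * n / Real.log n ^ 2 = n * (C' / Real.log n ^ 2) by ring] at h2
    exact le_of_mul_le_mul_left h2 hn0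
  calc |∑ k ∈ Icc 1 n, (μ k : ℝ) * Real.log k / k + 1|
      ≤ C * Real.exp (-c * Real.sqrt (Real.log n)) := h1
    _ ≤ max C 0 * Real.exp (-c * Real.sqrt (Real.log n)) :=
        mul_le_mul_of_nonneg_right (le_max_left _ _) (Real.exp_pos _).le
    _ ≤ max C 0 * (C' / Real.log n ^ 2) := mul_le_mul_of_nonneg_left h3 (le_max_right _ _)
    _ = max C 0 * C' / Real.log n ^ 2 := by ring

/-- Uniform bound `|m(n)| ≤ K` for all `n` (`m(0) = 0`, `m(1) = 1`). [folklore] -/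
theorem exists_abs_sum_moebius_div_le :
    ∃ K : ℝ, 0 ≤ K ∧ ∀ n : ℕ, |∑ k ∈ Icc 1 n, (μ k : ℝ) / k| ≤ K := by
  obtain ⟨C, hC0, hC⟩ := exists_abs_sum_moebius_div_le_div_log_sq
  refine ⟨C / Real.log 2 ^ 2 + 1, by positivity, fun n => ?_⟩
  rcases lt_or_ge n 2 with hn | hn
  · interval_cases n
    · simp; positivity
    · simp; positivity
  · have hlog : Real.log 2 ≤ Real.log n :=
      Real.log_le_log two_pos (by exact_mod_cast hn)
    have hl2 : 0 < Real.log 2 := Real.log_pos one_lt_two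
    calc |∑ k ∈ Icc 1 n, (μ k : ℝ) / k| ≤ C / Real.log n ^ 2 := hC n hn
      _ ≤ C / Real.log 2 ^ 2 := by gcongr
      _ ≤ C / Real.log 2 ^ 2 + 1 := by linarith

/-- Uniform bound `|m₁(n) + 1| ≤ K` for all `n` (`m₁(0) = m₁(1) = 0`). [folklore] -/
theorem exists_abs_sum_moebius_log_div_add_one_le :
    ∃ K : ℝ, 0 ≤ K ∧ ∀ n : ℕ, |∑ k ∈ Icc 1 n, (μ k : ℝ) * Real.log k / k + 1| ≤ K := by
  obtain ⟨C, hC0, hC⟩ := exists_abs_sum_moebius_log_div_add_one_le_div_log_sq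
  refine ⟨C / Real.log 2 ^ 2 + 1, by positivity, fun n => ?_⟩
  rcases lt_or_ge n 2 with hn | hn
  · interval_cases n
    · simp; positivity
    · simp; positivity
  · have hlog : Real.log 2 ≤ Real.log n :=
      Real.log_le_log two_pos (by exact_mod_cast hn)
    have hl2 : 0 < Real.log 2 := Real.log_pos one_lt_two
    calc |∑ k ∈ Icc 1 n, (μ k : ℝ) * Real.log k / k + 1| ≤ C / Real.log n ^ 2 := hC n hn
      _ ≤ C / Real.log 2 ^ 2 := by gcongr
      _ ≤ C / Real.log 2 ^ 2 + 1 := by linarith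

/-- Trivial bound `|M(n)| ≤ n`. [folklore] -/
theorem abs_sum_moebius_le_self (n : ℕ) : |∑ k ∈ Icc 1 n, (μ k : ℝ)| ≤ n := by
  calc |∑ k ∈ Icc 1 n, (μ k : ℝ)| ≤ ∑ k ∈ Icc 1 n, |(μ k : ℝ)| := abs_sum_le_sum_abs _ _
    _ ≤ ∑ k ∈ Icc 1 n, (1 : ℝ) := by
        refine Finset.sum_le_sum fun k _ => ?_
        have := ArithmeticFunction.abs_moebius_le_one (n := k)
        exact_mod_cast this
    _ = n := by simp


/-! ### Elementary inequalities for the splitting at `n² ≤ D` -/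

/-- For `1 ≤ n`, `n² ≤ D`, `D ≥ 64` and `q = ⌊D/n⌋`: `q ≥ 2` and `log D ≤ 3 log q`. [folklore] -/
theorem two_le_div_and_log_le {n D : ℕ} (hn : 1 ≤ n) (hnD : n * n ≤ D) (hD : 64 ≤ D) :
    2 ≤ D / n ∧ Real.log D ≤ 3 * Real.log (D / n : ℕ) := by
  set q := D / n with hq
  have h1 : D < n * (q + 1) := Nat.lt_mul_div_succ D hn
  have h2 : n ≤ q := (Nat.le_div_iff_mul_le hn).2 hnD
  have h3 : D < 2 * q * q := by nlinarith
  have hq6 : 6 ≤ q := by nlinarith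
  refine ⟨by omega, ?_⟩
  have hq0 : (0 : ℝ) < q := by exact_mod_cast (by omega : 0 < q)
  have hD0 : (0 : ℝ) < D := by exact_mod_cast (by omega : 0 < D)
  have h3' : (D : ℝ) ≤ 2 * q * q := by exact_mod_cast h3.le
  have hlogD : Real.log D ≤ Real.log 2 + 2 * Real.log q := by
    calc Real.log D ≤ Real.log (2 * q * q) := Real.log_le_log hD0 h3'
      _ = Real.log 2 + 2 * Real.log q := by
          rw [mul_assoc, Real.log_mul two_ne_zero (by positivity), Real.log_mul hq0.ne' hq0.ne']
          ring
  have h64 : 6 * Real.log 2 ≤ Real.log D := by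
    have e : Real.log ((2 : ℝ) ^ 6) = 6 * Real.log 2 := by
      rw [Real.log_pow]; norm_num
    rw [← e]
    exact Real.log_le_log (by norm_num) (by exact_mod_cast hD)
  have hlq : 0 ≤ Real.log q := Real.log_nonneg (by exact_mod_cast (by omega : 1 ≤ q))
  linarith

/-- For `1 ≤ n` and `0 < D < n²`: `1/n ≤ D^{-1/4}/√n`. [folklore] -/
theorem one_div_le_rpow_div_sqrt {n D : ℕ} (hn : 1 ≤ n) (hD : 0 < D) (hnD : D < n * n) :
    1 / (n : ℝ) ≤ (D : ℝ) ^ (-(1 / 4 : ℝ)) / Real.sqrt n := by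
  have hn0 : (0 : ℝ) < n := by exact_mod_cast hn
  have hD0 : (0 : ℝ) < D := by exact_mod_cast hD
  have hD' : (D : ℝ) ≤ (n : ℝ) ^ 2 := by exact_mod_cast (by nlinarith : D ≤ n ^ 2)
  have h1 : (D : ℝ) ^ (1 / 4 : ℝ) ≤ Real.sqrt n := by
    calc (D : ℝ) ^ (1 / 4 : ℝ) ≤ ((n : ℝ) ^ 2) ^ (1 / 4 : ℝ) :=
          Real.rpow_le_rpow (Nat.cast_nonneg _) hD' (by norm_num)
      _ = (n : ℝ) ^ ((2 : ℝ) * (1 / 4)) := by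
          rw [← Real.rpow_natCast, ← Real.rpow_mul hn0.le]; norm_num
      _ = Real.sqrt n := by rw [Real.sqrt_eq_rpow]; norm_num
  have h4 : 0 < (D : ℝ) ^ (1 / 4 : ℝ) := Real.rpow_pos_of_pos hD0 _
  have hsq : 0 < Real.sqrt n := Real.sqrt_pos.mpr hn0
  rw [Real.rpow_neg hD0.le, div_le_div_iff₀ hn0 hsq, one_mul]
  calc Real.sqrt n = (Real.sqrt n)⁻¹ * (Real.sqrt n * Real.sqrt n) := by
        field_simp
    _ = (Real.sqrt n)⁻¹ * n := by rw [Real.mul_self_sqrt hn0.le]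
    _ ≤ ((D : ℝ) ^ (1 / 4 : ℝ))⁻¹ * n := by
        gcongr

/-- `(log n + 1)/n ≤ 3/√n` for `n ≥ 1` (`log n ≤ 2√n`). [folklore] -/
theorem log_add_one_div_le {n : ℕ} (hn : 1 ≤ n) :
    (Real.log n + 1) / n ≤ 3 / Real.sqrt n := by
  have hn0 : (0 : ℝ) < n := by exact_mod_cast hn
  have hsq : 0 < Real.sqrt n := Real.sqrt_pos.mpr hn0
  have hsq1 : 1 ≤ Real.sqrt n := by
    rw [← Real.sqrt_one]; exact Real.sqrt_le_sqrt (by exact_mod_cast hn)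
  have hlog : Real.log n ≤ 2 * Real.sqrt n := by
    have := Real.log_le_rpow_div hn0.le (by norm_num : (0 : ℝ) < 1 / 2)
    rw [← Real.sqrt_eq_rpow] at this
    linarith
  rw [div_le_div_iff₀ hn0 hsq]
  calc (Real.log n + 1) * Real.sqrt n ≤ (3 * Real.sqrt n) * Real.sqrt n := by
        gcongr; linarith
    _ = 3 * n := by rw [mul_assoc, Real.mul_self_sqrt hn0.le]

/-- `(log n + 1)/n ≤ 5 D^{-1/8}/√n` for `1 ≤ n`, `0 < D < n²` (`log n ≤ 4 n^{1/4}`). [folklore] -/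
theorem log_add_one_div_le_rpow {n D : ℕ} (hn : 1 ≤ n) (hD : 0 < D) (hnD : D < n * n) :
    (Real.log n + 1) / n ≤ 5 * (D : ℝ) ^ (-(1 / 8 : ℝ)) / Real.sqrt n := by
  have hn0 : (0 : ℝ) < n := by exact_mod_cast hn
  have hn1 : (1 : ℝ) ≤ n := by exact_mod_cast hn
  have hD0 : (0 : ℝ) < D := by exact_mod_cast hD
  have hsq : 0 < Real.sqrt n := Real.sqrt_pos.mpr hn0
  set t : ℝ := (n : ℝ) ^ (1 / 4 : ℝ) with ht
  have ht0 : 0 < t := Real.rpow_pos_of_pos hn0 _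
  have ht1 : 1 ≤ t := Real.one_le_rpow hn1 (by norm_num)
  have hlog : Real.log n ≤ 4 * t := by
    have := Real.log_le_rpow_div hn0.le (by norm_num : (0 : ℝ) < 1 / 4)
    rw [← ht] at this
    linarith
  -- `n = t * t * √n`
  have hn_eq : (n : ℝ) = t * t * Real.sqrt n := by
    rw [ht, Real.sqrt_eq_rpow, ← Real.rpow_add hn0, ← Real.rpow_add hn0]
    norm_num
  -- `D^{1/8} ≤ t`
  have hD' : (D : ℝ) ≤ (n : ℝ) ^ 2 := by exact_mod_cast (by nlinarith : D ≤ n ^ 2)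
  have hDt : (D : ℝ) ^ (1 / 8 : ℝ) ≤ t := by
    calc (D : ℝ) ^ (1 / 8 : ℝ) ≤ ((n : ℝ) ^ 2) ^ (1 / 8 : ℝ) :=
          Real.rpow_le_rpow (Nat.cast_nonneg _) hD' (by norm_num)
      _ = t := by rw [ht, ← Real.rpow_natCast, ← Real.rpow_mul hn0.le]; norm_num
  have hD8 : 0 < (D : ℝ) ^ (1 / 8 : ℝ) := Real.rpow_pos_of_pos hD0 _
  rw [Real.rpow_neg hD0.le, div_le_div_iff₀ hn0 hsq]
  calc (Real.log n + 1) * Real.sqrt n ≤ (5 * t) * Real.sqrt n := by gcongr; linarith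
    _ = 5 * t⁻¹ * (t * t * Real.sqrt n) := by field_simp
    _ = 5 * t⁻¹ * n := by rw [← hn_eq]
    _ ≤ 5 * ((D : ℝ) ^ (1 / 8 : ℝ))⁻¹ * n := by gcongr

/-! ### The rearrangement `∑_{d ≤ D} (b ⋆ μ)(d) w(d) = ∑_{n ≤ D} b(n) ∑_{e ≤ D/n} μ(e) w(ne)` -/

/-- `∑_{d ≤ D} (b ⋆ μ)(d) w(d) = ∑_{n ≤ D} b(n) ∑_{e ≤ D/n} μ(e) w(ne)` (Dirichlet hyperbola
rearrangement of the convolution). [folklore] -/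
theorem sum_convMoebius_mul_eq (b : ArithmeticFunction ℝ) (w : ℕ → ℝ) (D : ℕ) :
    ∑ d ∈ Icc 1 D, (b * (μ : ArithmeticFunction ℝ)) d * w d =
      ∑ n ∈ Icc 1 D, b n * ∑ e ∈ Icc 1 (D / n), (μ e : ℝ) * w (n * e) := by
  have h1 : ∀ d ∈ Icc 1 D, (b * (μ : ArithmeticFunction ℝ)) d * w d =
      ∑ q ∈ d.divisorsAntidiagonal, b q.1 * (μ q.2 : ℝ) * w (q.1 * q.2) := by
    intro d _
    rw [mul_apply, Finset.sum_mul]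
    refine Finset.sum_congr rfl fun q hq => ?_
    rw [(Nat.mem_divisorsAntidiagonal.mp hq).1, intCoe_apply]
  rw [Finset.sum_congr rfl h1,
    Literature.NumberTheory.Sieve.SquarefreeSums.sum_Icc_sum_divisorsAntidiagonal
      (fun n e => b n * (μ e : ℝ) * w (n * e)) D]
  refine Finset.sum_congr rfl fun n _ => ?_
  rw [Finset.mul_sum]
  refine Finset.sum_congr rfl fun e _ => ?_
  ring

/-- A sub-sum of the nonnegative terms `|b n|/√n · c` (`c ≥ 0`) over a filter of `[1, D]` is at most
`S c`. [folklore] -/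
theorem sum_filter_abs_div_sqrt_mul_le (b : ArithmeticFunction ℝ) {S : ℝ}
    (hS : ∀ N, ∑ n ∈ Icc 1 N, |b n| / Real.sqrt n ≤ S) (D : ℕ) (P : ℕ → Prop)
    [DecidablePred P] {c : ℝ} (hc : 0 ≤ c) :
    ∑ n ∈ (Icc 1 D).filter P, |b n| / Real.sqrt n * c ≤ S * c := by
  rw [← Finset.sum_mul]
  refine mul_le_mul_of_nonneg_right (le_trans ?_ (hS D)) hc
  exact Finset.sum_le_sum_of_subset_of_nonneg (Finset.filter_subset _ _)
    fun n _ _ => div_nonneg (abs_nonneg _) (Real.sqrt_nonneg _)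

end Summit.Parity.GeneralizedHardyLittlewood.Theorems.PairsFromMAvg
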